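import Mathlib
import Summits.CriticalPhenomena.CardyFormulaZ2.Theorems.CardyMagicRigidityDefs
import Summits.CriticalPhenomena.CardyFormulaZ2.Theorems.CardyMagicRigidityPositiveConeDefs
import Summits.CriticalPhenomena.CardyFormulaZ2.Theorems.CardyMagicRigidityNestingRigidityPrecompactnessRegularLimit
import Literature.Probability.Percolation.FullPlaneCNL
import Literature.Probability.Percolation.LoopRepresentationProofs
import Literature.Probability.RandomPlanarGeometry.LocFinLoopConfig
import HarnessLib

/-!
# Stub `stub_precompactness`, regular limits: a.e. sample of a `d_CN`-limit law is a limit of lattice samples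

Crux `Summit.CriticalPhenomena.CardyFormulaZ2.Theses.CardyMagicRigidity.NestingRigidity`
(stmt-CriticalPhenomena-4835), line `positive-cone-weight-doubling`, registered stub `stub_precompactness :
PrecompactRegular zEns ∧ PrecompactRegular tEns`.  The companion file `…PrecompactnessRegularLimit` (p128987)
proves, at the CONFIGURATION level, that covering degree one and laminarity pass to configurations which are
`d_CN ≤ η`-close at every scale to configurations having them.  This file supplies the MEASURE-THEORETIC step that
turns it into an almost-sure statement about `d_CN`-limit LAWS (the soft half of T2 of the stub map): if the laws
of random configurations `Y k` (on a standard Borel probability space) converge in DKKMO's coupling distance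
`LoopConfig.cnLawEDist` to the law of `X` (on any finite measure space), and the exceptional events
`{(ω, s) | d_CN(Y k ω, X s) ≤ ε}` are measurable, then for a.e. `s` the sample `X s` is, at every scale `η > 0`,
`d_CN ≤ η`-close to SOME sample `Y k ω`:

* `Precompact.exists_measurableSet_superset_forall_section` — the co-projection bound: for a finite measure `P`
  on `Ω × Ω'` with `Ω` standard Borel and a measurable `B`, the set `{s | ∀ ω, (ω, s) ∈ B}` of points whose whole
  fibre lies in `B` is contained in a MEASURABLE `T` with `(snd_* P)(T) ≤ 2 P(B)` (disintegrate `P` over the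
  second coordinate, `Measure.condKernel`; on such `s` the conditional mass of the fibre is `1 ≥ 1/2`; Markov);
* `Precompact.ae_forall_exists_isClose_of_tendsto_cnLawEDist` — Borel–Cantelli along the scales `2^{-j}`: pick
  `k j` with `d_CN(law Y (k j), law X) < 2^{-j}`, a coupling `P j` with `P j[d_CN > 2^{-j}] < 2^{-j}`
  (`LoopConfig.exists_coupling_of_cnLawEDist_lt`), the measurable `T j ⊇ {s | no sample of Y (k j) is
  2^{-j}-close to X s}` with `ν(T j) ≤ 2 · 2^{-j}`, and `measure_limsup_atTop_eq_zero`;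
* `ae_degreeOne_laminar_of_tendsto_cnLawEDist` (registered anchor) — for a lattice ensemble
  `E ∈ latticeEnsembles` (standard Borel sample spaces `standardBorelSpace_bondConfig/siteConfig`, all samples
  `Regular` at positive mesh, `regular_latticeEnsembles`) and a mesh sequence `δₖ → 0⁺`: if
  `cnLawEDist E.P (E.X δₖ) ν X → 0` with measurable exceptional events, then for `ν`-a.e. `s` every loop of `X s`
  has winding numbers in `{0, ±1}` and any two loops of `X s` have nested or disjoint winding interiors
  (`Precompact.degreeOne_laminar_of_forall_isClose_latticeEnsembles`).

So, of the five fields of `Regular` asked of a limit presentation, `degreeOne` and `laminar` hold a.s. for EVERY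
`d_CN`-limit presentation with measurable exceptional events (no modification needed); `locallyFinite`,
`boundary`, `separating` remain (they need uniform lattice estimates and, for `locallyFinite`, a modification of
the presentation: `d_CN` sees members only up to closure and reversal).
-/

noncomputable section

open MeasureTheory ProbabilityTheory Set Filter Metric
open scoped Real Topology BigOperators ENNReal

namespace Summit.CriticalPhenomena.CardyFormulaZ2.Cruxes.NestingRigidity.PositiveConeWeightDoubling

open Literature.Probability.RandomPlanarGeometry Literature.Probability.Percolation
  Literature.Probability.LatticeModels
open Summit.CriticalPhenomena.CardyFormulaZ2.Theses.CardyMagicRigidity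
open Summit.CriticalPhenomena.CardyFormulaZ2.Cruxes.NestingRigidity.RingCloudTomography

namespace Precompact

/-! ### The co-projection bound -/

section CoProjection

variable {Ω Ω' : Type*} [MeasurableSpace Ω] [MeasurableSpace Ω']

/-- **Co-projection bound.**  For a finite measure `P` on `Ω × Ω'` with `Ω` standard Borel and a measurable
`B ⊆ Ω × Ω'`, the set of `s` whose whole fibre `Ω × {s}` lies in `B` is contained in a measurable `T` with
`(snd_* P)(T) ≤ 2 P(B)`: disintegrating `P` over the second coordinate (`Measure.condKernel` of the swapped
measure), the conditional mass of the fibre of `B` is a measurable function of `s`, equal to `1` on such `s`, and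
its integral is `P(B)` — Markov at level `1/2`. -/
theorem exists_measurableSet_superset_forall_section [StandardBorelSpace Ω] [Nonempty Ω]
    (P : Measure (Ω × Ω')) [IsFiniteMeasure P] {B : Set (Ω × Ω')} (hB : MeasurableSet B) :
    ∃ T : Set Ω', MeasurableSet T ∧ {s | ∀ ω, (ω, s) ∈ B} ⊆ T ∧ P.map Prod.snd T ≤ 2 * P B := by
  set P' : Measure (Ω' × Ω) := P.map Prod.swap with hP'
  set κ : Kernel Ω' Ω := P'.condKernel with hκ
  have hdis : P'.fst ⊗ₘ κ = P' := P'.disintegrate κ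
  set B' : Set (Ω' × Ω) := Prod.swap ⁻¹' B with hB'def
  have hB' : MeasurableSet B' := measurable_swap hB
  have hPB' : P' B' = P B := by
    rw [hP', Measure.map_apply measurable_swap hB', hB'def, ← Set.preimage_comp]
    simp
  set f : Ω' → ℝ≥0∞ := fun s ↦ κ s (Prod.mk s ⁻¹' B') with hf
  have hfm : Measurable f := Kernel.measurable_kernel_prodMk_left hB'
  have hint : ∫⁻ s, f s ∂P'.fst = P B := by
    rw [← hPB', ← Measure.compProd_apply hB', hdis]
  have hfst : P'.fst = P.map Prod.snd := by
    rw [Measure.fst, hP', Measure.map_map measurable_fst measurable_swap]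
    rfl
  refine ⟨{s | 2⁻¹ ≤ f s}, measurableSet_le measurable_const hfm, fun s hs ↦ ?_, ?_⟩
  · have huniv : Prod.mk s ⁻¹' B' = univ := eq_univ_of_forall fun ω ↦ hs ω
    show 2⁻¹ ≤ κ s (Prod.mk s ⁻¹' B')
    rw [huniv, measure_univ]
    exact ENNReal.one_half_lt_one.le
  · have hmarkov := mul_meas_ge_le_lintegral₀ (μ := P'.fst) hfm.aemeasurable 2⁻¹
    rw [hint, hfst] at hmarkov
    rw [← hfst] at hmarkov ⊢
    calc P'.fst {s | 2⁻¹ ≤ f s} = 2 * (2⁻¹ * P'.fst {s | 2⁻¹ ≤ f s}) := by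
          rw [← mul_assoc, ENNReal.mul_inv_cancel two_ne_zero ENNReal.ofNat_ne_top, one_mul]
      _ ≤ 2 * P B := by gcongr

end CoProjection

/-! ### Borel–Cantelli: a.e. sample of the limit is a `d_CN`-limit of samples -/

section BorelCantelli

variable {E : Type*} [NormedAddCommGroup E]
variable {Ω Ω' : Type*} [MeasurableSpace Ω] [MeasurableSpace Ω']

/-- The dyadic scales as extended reals: `ofReal ((1/2)^j) = 2⁻¹ ^ j`. -/
theorem ofReal_half_pow (j : ℕ) : ENNReal.ofReal ((1 / 2 : ℝ) ^ j) = (2⁻¹ : ℝ≥0∞) ^ j := by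
  rw [ENNReal.ofReal_pow (by norm_num), one_div, ENNReal.ofReal_inv_of_pos two_pos, ENNReal.ofReal_ofNat]

/-- **A.e. sample of a `d_CN`-limit law is, at every scale, `d_CN`-close to some approximating sample.**  If
the laws of `Y k` (on a standard Borel space) converge in DKKMO's coupling distance to the law of `X` under the
finite measure `ν`, with measurable exceptional events `{(ω, s) | d_CN(Y k ω, X s) ≤ ε}`, then for `ν`-a.e. `s`:
for every `η > 0` there are `k` and `ω` with `d_CN(Y k ω, X s) ≤ η` (printed relation `LoopConfig.IsClose`). -/
theorem ae_forall_exists_isClose_of_tendsto_cnLawEDist [StandardBorelSpace Ω] [Nonempty Ω]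
    (μ : Measure Ω) (ν : Measure Ω') [IsFiniteMeasure ν] {Y : ℕ → Ω → LoopConfig E} {X : Ω' → LoopConfig E}
    (hm : ∀ (k : ℕ) (ε : ℝ), MeasurableSet {p : Ω × Ω' | LoopConfig.IsClose ε (Y k p.1) (X p.2)})
    (h : Tendsto (fun k ↦ LoopConfig.cnLawEDist μ (Y k) ν X) atTop (𝓝 0)) :
    ∀ᵐ s ∂ν, ∀ η : ℝ, 0 < η → ∃ (k : ℕ) (ω : Ω), LoopConfig.IsClose η (Y k ω) (X s) := by
  set ε : ℕ → ℝ := fun j ↦ (1 / 2 : ℝ) ^ j with hεdef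
  have hε : ∀ j, 0 < ε j := fun j ↦ by positivity
  -- indices with `d_CN < ε j`
  have hk : ∀ j : ℕ, ∃ k, LoopConfig.cnLawEDist μ (Y k) ν X < ENNReal.ofReal (ε j) := fun j ↦
    (h.eventually (Iio_mem_nhds (ENNReal.ofReal_pos.2 (hε j)))).exists
  choose k hk using hk
  -- couplings
  have hP : ∀ j, ∃ P : Measure (Ω × Ω'), P.map Prod.fst = μ ∧ P.map Prod.snd = ν ∧
      P {p | ¬ LoopConfig.IsClose (ε j) (Y (k j) p.1) (X p.2)} < ENNReal.ofReal (ε j) := fun j ↦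
    LoopConfig.exists_coupling_of_cnLawEDist_lt (hk j)
  choose P hP₁ hP₂ hP₃ using hP
  haveI : ∀ j, IsFiniteMeasure (P j) := fun j ↦ ⟨by
    rw [← Set.preimage_univ (f := (Prod.snd : Ω × Ω' → Ω')),
      ← Measure.map_apply measurable_snd MeasurableSet.univ, hP₂]
    exact measure_lt_top ν univ⟩
  -- measurable supersets of the "no close sample" sets
  have hT : ∀ j, ∃ T : Set Ω', MeasurableSet T ∧
      {s | ∀ ω, ¬ LoopConfig.IsClose (ε j) (Y (k j) ω) (X s)} ⊆ T ∧ ν T ≤ 2 * ENNReal.ofReal (ε j) := by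
    intro j
    obtain ⟨T, hTm, hTsub, hTle⟩ :=
      exists_measurableSet_superset_forall_section (P j) (hm (k j) (ε j)).compl
    refine ⟨T, hTm, hTsub, ?_⟩
    rw [hP₂] at hTle
    refine hTle.trans ?_
    gcongr
    exact (hP₃ j).le
  choose T hTm hTsub hTle using hT
  -- Borel–Cantelli
  have hsum : ∑' j, ν (T j) ≠ ⊤ := by
    have hgeo : ∑' j : ℕ, 2 * (2⁻¹ : ℝ≥0∞) ^ j ≠ ⊤ := by
      rw [ENNReal.tsum_mul_left, ENNReal.tsum_geometric_two]
      norm_num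
    exact ne_top_of_le_ne_top hgeo (ENNReal.tsum_le_tsum fun j ↦ by rw [← ofReal_half_pow]; exact hTle j)
  have hlim : ν (limsup T atTop) = 0 := measure_limsup_atTop_eq_zero hsum
  have hε0 : Tendsto ε atTop (𝓝 0) := tendsto_pow_atTop_nhds_zero_of_lt_one (by norm_num) (by norm_num)
  filter_upwards [measure_eq_zero_iff_ae_notMem.1 hlim] with s hs
  intro η hη
  rw [Filter.mem_limsup_iff_frequently_mem, Filter.not_frequently] at hs
  obtain ⟨j, hjT, hjε⟩ := (hs.and (hε0.eventually (Iio_mem_nhds hη))).exists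
  have hex : ¬ ∀ ω, ¬ LoopConfig.IsClose (ε j) (Y (k j) ω) (X s) := fun hall ↦ hjT (hTsub j hall)
  push Not at hex
  obtain ⟨ω, hω⟩ := hex
  exact ⟨k j, ω, hω.mono (hε j) hjε.le⟩

end BorelCantelli

/-! ### The lattice ensembles: standard Borel sample spaces -/

/-- The sample spaces of the two lattice ensembles are standard Borel and non-empty
(`BondConfig (Site 2) = Set (Sym2 ℤ²)`, `SiteConfig (Site 2) = Set ℤ²`). -/
theorem standardBorelSpace_nonempty_of_mem {E : LoopEnsemble} (hE : E ∈ latticeEnsembles) :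
    StandardBorelSpace E.Ω ∧ Nonempty E.Ω := by
  simp only [latticeEnsembles, Set.mem_insert_iff, Set.mem_singleton_iff] at hE
  rcases hE with rfl | rfl
  · exact ⟨standardBorelSpace_bondConfig, ⟨(∅ : Set (Sym2 (Site 2)))⟩⟩
  · exact ⟨standardBorelSpace_siteConfig, ⟨(∅ : Set (Site 2))⟩⟩

end Precompact

open Precompact in
/-- **A.e. sample of a `d_CN`-limit law of a lattice ensemble has `degreeOne` and `laminar` loops (registered
anchor).**  Let `E ∈ latticeEnsembles` (bond-`ℤ²` or site-`𝕋`), `δₖ → 0⁺` a mesh sequence and `X : Ω' → C` a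
presentation, on a finite measure space, of a `d_CN`-limit of the laws of `E.X δₖ`
(`cnLawEDist E.P (E.X δₖ) ν X → 0`) whose exceptional events against the lattice samples are measurable.  Then for
`ν`-a.e. `s`, every loop of `X s` has winding numbers in `{0, ±1}` everywhere, and any two loops of `X s` have
nested or disjoint winding interiors.  Proof: a.e. `X s` is at every scale `d_CN`-close to some positive-mesh
lattice sample (`Precompact.ae_forall_exists_isClose_of_tendsto_cnLawEDist`), all of which are `Regular`
(`regular_latticeEnsembles`), and the two properties pass to such limits
(`Precompact.degreeOne_laminar_of_forall_isClose_latticeEnsembles`). -/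
theorem ae_degreeOne_laminar_of_tendsto_cnLawEDist : ∀ E ∈ latticeEnsembles, ∀ (δs : ℕ → ℝ)
    {Ω' : Type} [MeasurableSpace Ω'] (ν : Measure Ω') [IsFiniteMeasure ν] (X : Ω' → LoopConfig ℂ),
    Tendsto δs atTop (𝓝[>] (0 : ℝ)) →
    (∀ (k : ℕ) (ε : ℝ), MeasurableSet {p : E.Ω × Ω' | LoopConfig.IsClose ε (E.X (δs k) p.1) (X p.2)}) →
    Tendsto (fun k : ℕ ↦ LoopConfig.cnLawEDist E.P (E.X (δs k)) ν X) atTop (𝓝 0) →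
    ∀ᵐ s ∂ν, (∀ u ∈ (X s).loops, ∀ z : ℂ, u.wind z = 0 ∨ u.wind z = 1 ∨ u.wind z = -1) ∧
      ∀ u ∈ (X s).loops, ∀ v ∈ (X s).loops,
        {z | u.wind z ≠ 0} ⊆ {z | v.wind z ≠ 0} ∨ {z | v.wind z ≠ 0} ⊆ {z | u.wind z ≠ 0} ∨
          Disjoint {z | u.wind z ≠ 0} {z | v.wind z ≠ 0} := by
  intro E hE δs Ω' _ ν _ X hδs hm h
  obtain ⟨hSB, hne⟩ := standardBorelSpace_nonempty_of_mem hE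
  haveI := hSB
  haveI := hne
  -- eventually positive meshes: shift the sequence
  obtain ⟨K, hK⟩ := eventually_atTop.1 (hδs.eventually (self_mem_nhdsWithin : Set.Ioi (0 : ℝ) ∈ 𝓝[>] 0))
  have h' : Tendsto (fun j : ℕ ↦ LoopConfig.cnLawEDist E.P (E.X (δs (j + K))) ν X) atTop (𝓝 0) :=
    h.comp (tendsto_add_atTop_nat K)
  have hae := ae_forall_exists_isClose_of_tendsto_cnLawEDist E.P ν (Y := fun j ↦ E.X (δs (j + K)))
    (fun j ε ↦ hm (j + K) ε) h'
  filter_upwards [hae] with s hs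
  refine degreeOne_laminar_of_forall_isClose_latticeEnsembles fun η hη ↦ ?_
  obtain ⟨j, ω, hω⟩ := hs η hη
  exact ⟨E, hE, δs (j + K), ω, hK _ (Nat.le_add_left K j), hω⟩

/-- The same for a presentation on the unit interval with Lebesgue measure (the frame of `PrecompactRegular`):
`degreeOne` and `laminar` hold a.s. for every sequential `d_CN`-limit presentation of `zEns` or `tEns` with
measurable exceptional events — two of the five fields of `Regular`, with no modification of `X`. -/
theorem ae_degreeOne_laminar_unitInterval {E : LoopEnsemble} (hE : E ∈ latticeEnsembles) {δs : ℕ → ℝ}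
    (hδs : Tendsto δs atTop (𝓝[>] (0 : ℝ))) {X : unitInterval → LoopConfig ℂ}
    (hm : ∀ (k : ℕ) (ε : ℝ), MeasurableSet {p : E.Ω × unitInterval | LoopConfig.IsClose ε (E.X (δs k) p.1) (X p.2)})
    (h : Tendsto (fun k : ℕ ↦ LoopConfig.cnLawEDist E.P (E.X (δs k)) volume X) atTop (𝓝 0)) :
    ∀ᵐ s : unitInterval, (∀ u ∈ (X s).loops, ∀ z : ℂ, u.wind z = 0 ∨ u.wind z = 1 ∨ u.wind z = -1) ∧
      ∀ u ∈ (X s).loops, ∀ v ∈ (X s).loops,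
        {z | u.wind z ≠ 0} ⊆ {z | v.wind z ≠ 0} ∨ {z | v.wind z ≠ 0} ⊆ {z | u.wind z ≠ 0} ∨
          Disjoint {z | u.wind z ≠ 0} {z | v.wind z ≠ 0} :=
  ae_degreeOne_laminar_of_tendsto_cnLawEDist E hE δs volume X hδs hm h

end Summit.CriticalPhenomena.CardyFormulaZ2.Cruxes.NestingRigidity.PositiveConeWeightDoubling

end
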